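import Summits.SmoothPoincare4.SmoothPoincare4.Theses.SblfDescent
import Summits.SmoothPoincare4.SmoothPoincare4.Theorems.SblfDescentStepTwoReduction
import Summits.SmoothPoincare4.SmoothPoincare4.Theorems.SblfDescentRungOne
import Summits.SmoothPoincare4.SmoothPoincare4.Theorems.SblfDescentSblfExistsShield
import Summits.SmoothPoincare4.SmoothPoincare4.Theorems.StepTwo.Negative.SameMapObstruction
import Literature.Topology.FourManifolds.SimplifiedBrokenLefschetzFibration
import Literature.Topology.FourManifolds.GenusOneSblfOnSphereFourProofs
import Literature.Topology.FourManifolds.SphereFourFibredRegluing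

/-!
# Line `fibred_regluing` on crux `SblfDescent.StepTwo` (stmt-SmoothPoincare4-18529)

Forward ladder G4 (gen 4, seed stmt-SmoothPoincare4-18530 `SblfExists`, top_equivalence
`Theorems.sblfExists_iff_smoothPoincare4_of_descent`): the GLUING-GENUS dial.  Skeleton:
`StepTwo_of` ⇐ `stub_torusRegluingOfSphereFour` (GAP: every genus-2 simplified broken Lefschetz fibration
on a homotopy 4-sphere is a fibred torus regluing of one on `S⁴` — hardest) + `stub_torusRegluingRecognition`
(RUNG `TorusRegluingRecognition = FibredRegluingRecognition 1`: a homotopy 4-sphere which is ONE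
multiplicity-one logarithmic transformation of `S⁴` along a lower torus fibre of a genus-2 simplified broken
Lefschetz fibration is `S⁴`), through the landed `helper_stepTwo_of_genusTwoRecognition` and the PROVED
Auroux–Donaldson–Katzarkov fibration of `S⁴`.  rung_decl =
`Summit.SmoothPoincare4.SmoothPoincare4.Cruxes.StepTwo.FibredRegluing.TorusRegluingRecognition`; floor (F3)
`fibredRegluingRecognition_zero_of_rungOne` / witness `fibredRegluingRecognition_zero_of_fact` (Hayano 2011
Cor. 4.11) and, in gluing language, the PROVED fibred Gluck regluing
`Literature.Topology.FourManifolds.nonempty_diffeomorph_sphere_four_of_isBoundaryGluing_fibred`; on-path (F4)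
`torusRegluingRecognition_of_smoothPoincare4`, `regluingOfSphereFour_of_smoothPoincare4`; BOTH stubs are
NECESSARY for the crux (`torusRegluingOfSphereFour_of_stepTwo_of_rungOne`; the rung is implied by the apex of
line `Sketch` by discarding hypotheses).
Honours `Cruxes/StepTwo/Disproof.lean`: `stepTwo_false_without_homotopySphere` (every statement keeps the
hypothesis `X ≃ₕ S⁴` — for the rung it is essential: directions `(a,b)` of the log transform that change
`π₁` exist as soon as the lower torus is knotted), `not_sameMap` / `Negative.SameMapObstruction` (no statement
changes the lower genus of a fixed map; the gap produces a map on ANOTHER manifold, `S⁴`),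
`Negative.RefutationCost` (refuting either stub costs an exotic 4-sphere: both are on-path).

Dial (in `SblfExists`' own language).  A simplified broken Lefschetz fibration of lower genus `h` is
`(Σ_{h+1} × D² ∪ Lefschetz 2-handles) ∪ (round cobordism) ∪ (Σ_h × D²)`; all but the lower side is read off
the Hurwitz cycle system, and the lower side is glued back by a loop in `Diff⁺(Σ_h)` — ambiguity
`π₁(Diff⁺(Σ_h))`: `h ≥ 2` none (`Diff₀(Σ_h)` contractible, Earle–Eells: the step `Φ_l` of Baykur–Hayano
arXiv:1410.5531 Thm. 3.9, which therefore needs `g ≥ 3`, Rem. 3.10); `h = 0`: `ℤ/2`, the Gluck twist — the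
route's floor `RungOne` (in print) and the tree's PROVED fibred regluing theorem; `h = 1`: `ℤ²`, one
multiplicity-one log transform along the lower torus — THE RUNG, the last open notch of this dial.  Known
sub-cases of the rung in print: lower torus unknotted (Montesinos 1983; Larson arXiv:1502.06834 Thm. 19; tree
fact `nonempty_diffeomorph_sphere_four_of_torusSurgery_unknotted`), torus `T²`-knots (Iwase 1988 Thm. 1.3),
fishtail directions (Gompf; Larson Thm. 5).  Ceiling of the unrestricted method: every homotopy 4-sphere is a
SEQUENCE of log transforms of `S⁴` (Baykur–Sunukjian arXiv:1009.0514 Cor. 11), so torus-surgery rigidity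
without the one-step / lower-fibre / genus-2 restriction is the summit.

Typing (no gluing vocabulary): "`X` is a fibred regluing of `(S⁴, f₀)` along the fibre over a lower-regular
value `y₀`" := an open partial diffeomorphism `Ψ : X ∖ f⁻¹{y₀} ≅ S⁴ ∖ f₀⁻¹{y₀}` with `f₀ ∘ Ψ = f`
(`IsFibredAgreementOff`).
-/

set_option linter.dupNamespace false

namespace Summit.SmoothPoincare4.SmoothPoincare4.Cruxes.StepTwo.FibredRegluing

open scoped Manifold ContDiff Topology ContinuousMap
open Literature.Topology.FourManifolds
open Summit.SmoothPoincare4.SmoothPoincare4.Theses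
open Summit.SmoothPoincare4.SmoothPoincare4.Theorems

/-- Local notation: the round spheres `S⁴ ⊂ ℝ⁵`, `S² ⊂ ℝ³`. -/
local notation "𝕊⁴" => Metric.sphere (0 : EuclideanSpace ℝ (Fin 5)) 1
local notation "𝕊²" => Metric.sphere (0 : EuclideanSpace ℝ (Fin 3)) 1

/-- `y` is a LOWER regular value of `f` (lower genus `h`): every point over `y` is regular and the fibre
has `H₁ ≅ ℤ^{2h}` — verbatim the clause of `IsSimplifiedBrokenLefschetzFibration.exists_lower`. -/
def IsLowerRegularValue {X : Type} [TopologicalSpace X] [ChartedSpace (EuclideanSpace ℝ (Fin 4)) X]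
    (f : X → 𝕊²) (h : ℕ) (y : 𝕊²) : Prop :=
  (∀ q, f q = y → Function.Surjective (mfderiv (𝓡 4) (𝓡 2) f q)) ∧
    Nonempty ((Fin (2 * h) → ℤ) ≃ₗ[ℤ]
      Literature.AlgebraicTopology.SingularHomology.singularHomology ℤ ℤ ↥(f ⁻¹' {y}) 1)

/-- FIBRED AGREEMENT OFF THE FIBRE OVER `y₀`: `Ψ` is a diffeomorphism from `X ∖ f⁻¹{y₀}` onto
`Y ∖ f₀⁻¹{y₀}` with `f₀ ∘ Ψ = f` there.  ("`(X, f)` is `(Y, f₀)` reglued along the fibre over `y₀`.") -/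
def IsFibredAgreementOff {X Y : Type} [TopologicalSpace X] [ChartedSpace (EuclideanSpace ℝ (Fin 4)) X]
    [TopologicalSpace Y] [ChartedSpace (EuclideanSpace ℝ (Fin 4)) Y]
    (f : X → 𝕊²) (f₀ : Y → 𝕊²) (y₀ : 𝕊²) (Ψ : OpenPartialHomeomorph X Y) : Prop :=
  Ψ.source = (f ⁻¹' {y₀})ᶜ ∧ Ψ.target = (f₀ ⁻¹' {y₀})ᶜ ∧
    ContMDiffOn (𝓡 4) (𝓡 4) ∞ Ψ Ψ.source ∧ ContMDiffOn (𝓡 4) (𝓡 4) ∞ Ψ.symm Ψ.target ∧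
    ∀ x ∈ Ψ.source, f₀ (Ψ x) = f x

/-- RUNG FAMILY (gluing-genus dial, recognition form): a smooth homotopy 4-sphere `X` carrying a
simplified broken Lefschetz fibration `f` of lower genus `h` which agrees, off the fibre over a
lower-regular value `y₀`, with a simplified broken Lefschetz fibration `f₀` of lower genus `h` of the
ROUND sphere, is diffeomorphic to `S⁴`.  `h = 0` ⟸ `RungOne` (`fibredRegluingRecognition_zero_of_rungOne`);
`h ≥ 2`: in print (Baykur–Hayano Thm. 3.9: the Hurwitz systems agree, `Diff₀(Σ_h)` contractible);
`h = 1` = `TorusRegluingRecognition`, THE RUNG. -/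
def FibredRegluingRecognition (h : ℕ) : Prop :=
  ∀ (X : Type) [TopologicalSpace X] [T2Space X] [SecondCountableTopology X]
    [ChartedSpace (EuclideanSpace ℝ (Fin 4)) X] [IsManifold (𝓡 4) ((⊤ : ℕ∞) : WithTop ℕ∞) X],
    X ≃ₕ 𝕊⁴ →
    ∀ f : X → 𝕊², (∃ (o : SmoothOrientation (𝓡 4) X) (L : Finset X),
      IsSimplifiedBrokenLefschetzFibration o f L h) →
    ∀ f₀ : 𝕊⁴ → 𝕊², (∃ (o₀ : SmoothOrientation (𝓡 4) 𝕊⁴) (L₀ : Finset 𝕊⁴),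
      IsSimplifiedBrokenLefschetzFibration o₀ f₀ L₀ h) →
    ∀ y₀ : 𝕊², IsLowerRegularValue f h y₀ →
    ∀ Ψ : OpenPartialHomeomorph X 𝕊⁴, IsFibredAgreementOff f f₀ y₀ Ψ →
    Nonempty (Diffeomorph (𝓡 4) (𝓡 4) X 𝕊⁴ ((⊤ : ℕ∞) : WithTop ℕ∞))

/-- THE RUNG (`h = 1`): a homotopy 4-sphere obtained from a genus-2 simplified broken Lefschetz
fibration of `S⁴` by one fibred regluing of the lower side `T² × D²` — i.e. by ONE multiplicity-one
logarithmic transformation along a lower torus fibre — is `S⁴`.  (For every direction `(a,b)`: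
directions changing the homotopy type are excluded by the hypothesis `X ≃ₕ S⁴`.) -/
def TorusRegluingRecognition : Prop := FibredRegluingRecognition 1

/-- GAP FAMILY: every simplified broken Lefschetz fibration of lower genus `h` on a smooth homotopy
4-sphere is a fibred regluing, along the fibre over one of ITS lower-regular values, of a simplified
broken Lefschetz fibration of lower genus `h` of the round `S⁴`.  (A consequence of the summit by
transport — `regluingOfSphereFour_of_recognition`; as a statement short of it: a census of genus-`(h+1)`
Hurwitz systems of homotopy spheres — all realised on `S⁴` — plus Baykur–Hayano-type uniqueness of the
higher side and round cobordism.) -/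
def RegluingOfSphereFour (h : ℕ) : Prop :=
  ∀ (X : Type) [TopologicalSpace X] [T2Space X] [SecondCountableTopology X]
    [ChartedSpace (EuclideanSpace ℝ (Fin 4)) X] [IsManifold (𝓡 4) ((⊤ : ℕ∞) : WithTop ℕ∞) X],
    X ≃ₕ 𝕊⁴ →
    ∀ f : X → 𝕊², (∃ (o : SmoothOrientation (𝓡 4) X) (L : Finset X),
      IsSimplifiedBrokenLefschetzFibration o f L h) →
    ∃ f₀ : 𝕊⁴ → 𝕊², (∃ (o₀ : SmoothOrientation (𝓡 4) 𝕊⁴) (L₀ : Finset 𝕊⁴),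
      IsSimplifiedBrokenLefschetzFibration o₀ f₀ L₀ h) ∧
      ∃ y₀ : 𝕊², IsLowerRegularValue f h y₀ ∧
        ∃ Ψ : OpenPartialHomeomorph X 𝕊⁴, IsFibredAgreementOff f f₀ y₀ Ψ

/-- THE GAP at `h = 1` (to `StepTwo`): every genus-2 simplified broken Lefschetz fibration on a homotopy
4-sphere is a fibred torus regluing (one multiplicity-one log transform along a lower torus fibre) of a
genus-2 simplified broken Lefschetz fibration of `S⁴`. -/
def TorusRegluingOfSphereFour : Prop := RegluingOfSphereFour 1

/-! ## Floor (F3), on-path (F4), composition — all sorry-free -/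

/-- F3 (instantiation): dial value `h = 0` follows from the route's floor item `RungOne`
(the regluing data are discarded). [this file] -/
theorem fibredRegluingRecognition_zero_of_rungOne (h1 : SblfDescent.RungOne) :
    FibredRegluingRecognition 0 := by
  intro X _ _ _ _ _ e f hf _ _ _ _ _ _
  obtain ⟨o, L, hf⟩ := hf
  exact h1 X e ((sblfDescent_has_zero_iff X).mp ⟨o, f, L, hf⟩)

/-- F3 WITNESS: dial value `h = 0` holds modulo the published genus-one classification (named fact
`nonempty_diffeomorph_sphere_four_of_sblf_genus_one`, Hayano 2011 Cor. 4.11), through the tree theorem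
`RungOne_of_sblfGenusOne`.  The fibred `h = 0` regluing itself (Gluck twist along a fibred sphere) is
PROVED in the tree: `nonempty_diffeomorph_sphere_four_of_isBoundaryGluing_fibred`. [cite: Hayano2011, Cor. 4.11] -/
theorem fibredRegluingRecognition_zero_of_fact
    (H : nonempty_diffeomorph_sphere_four_of_sblf_genus_one) : FibredRegluingRecognition 0 :=
  fibredRegluingRecognition_zero_of_rungOne (RungOne_of_sblfGenusOne H)

/-- F4 ON-PATH: every rung of the family is a consequence of the summit (all fibration data are
discarded), so refuting `FibredRegluingRecognition h` exhibits an exotic 4-sphere. [this file] -/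
theorem fibredRegluingRecognition_of_smoothPoincare4 (hS : _root_.SmoothPoincare4) (h : ℕ) :
    FibredRegluingRecognition h := by
  intro X _ _ _ _ _ e _ _ _ _ _ _ _ _
  exact hS X ‹_› ‹_› e

/-- The rung is on-path. [this file] -/
theorem torusRegluingRecognition_of_smoothPoincare4 (hS : _root_.SmoothPoincare4) :
    TorusRegluingRecognition :=
  fibredRegluingRecognition_of_smoothPoincare4 hS 1

/-- TRANSPORT: if every homotopy 4-sphere carrying a lower-genus-`h` SBLF is diffeomorphic to `S⁴`,
then every such SBLF is a fibred regluing of its own transport to `S⁴` (`Ψ` = the diffeomorphism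
restricted off the fibre).  Gives the on-path lemma for the gap and its necessity for `StepTwo`. [this file] -/
theorem regluingOfSphereFour_of_recognition (h : ℕ)
    (hR : ∀ (X : Type) [TopologicalSpace X] [T2Space X] [SecondCountableTopology X]
      [ChartedSpace (EuclideanSpace ℝ (Fin 4)) X] [IsManifold (𝓡 4) ((⊤ : ℕ∞) : WithTop ℕ∞) X],
      X ≃ₕ 𝕊⁴ →
      (∃ (o : SmoothOrientation (𝓡 4) X) (f : X → 𝕊²) (L : Finset X),
          IsSimplifiedBrokenLefschetzFibration o f L h) →
      Nonempty (Diffeomorph (𝓡 4) (𝓡 4) X 𝕊⁴ ((⊤ : ℕ∞) : WithTop ℕ∞))) :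
    RegluingOfSphereFour h := by
  intro X _ _ _ _ _ e f hf
  obtain ⟨o, L, hf⟩ := hf
  obtain ⟨Φ⟩ := hR X e ⟨o, f, L, hf⟩
  obtain ⟨y₀, hy₀⟩ := hf.exists_lower
  have hcont : Continuous f := hf.contMDiff.continuous
  have hopen : IsOpen (f ⁻¹' {y₀})ᶜ := ((isClosed_singleton).preimage hcont).isOpen_compl
  have hcont₀ : Continuous (f ∘ Φ.symm) := hcont.comp Φ.symm.continuous
  have hopen₀ : IsOpen ((f ∘ Φ.symm) ⁻¹' {y₀})ᶜ := ((isClosed_singleton).preimage hcont₀).isOpen_compl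
  let Ψ : OpenPartialHomeomorph X 𝕊⁴ :=
    { toFun := Φ
      invFun := Φ.symm
      source := (f ⁻¹' {y₀})ᶜ
      target := ((f ∘ Φ.symm) ⁻¹' {y₀})ᶜ
      map_source' := by
        intro x hx
        simpa [Set.mem_compl_iff, Set.mem_preimage, Function.comp, Diffeomorph.symm_apply_apply] using hx
      map_target' := by
        intro y hy
        simpa [Set.mem_compl_iff, Set.mem_preimage, Function.comp] using hy
      left_inv' := by intro x _; simp
      right_inv' := by intro y _; simp
      open_source := hopen
      open_target := hopen₀
      continuousOn_toFun := Φ.continuous.continuousOn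
      continuousOn_invFun := Φ.symm.continuous.continuousOn }
  refine ⟨f ∘ Φ.symm, ⟨_, _, sblf_comp_diffeomorph Φ.symm hf⟩, y₀, hy₀, Ψ, rfl, rfl, ?_, ?_, ?_⟩
  · exact Φ.contMDiff.contMDiffOn
  · exact Φ.symm.contMDiff.contMDiffOn
  · intro x _
    show f (Φ.symm (Φ x)) = f x
    simp

/-- F4 for the gap: `RegluingOfSphereFour h` is a consequence of the summit. [this file] -/
theorem regluingOfSphereFour_of_smoothPoincare4 (hS : _root_.SmoothPoincare4) (h : ℕ) :
    RegluingOfSphereFour h :=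
  regluingOfSphereFour_of_recognition h (fun X _ _ _ _ _ e _ => hS X ‹_› ‹_› e)

/-- F3 for the GAP family: dial value `h = 0` of `RegluingOfSphereFour` (every genus-1 simplified broken
Lefschetz fibration on a homotopy 4-sphere is a fibred sphere regluing of one on `S⁴`) follows from the route's
floor item `RungOne` by transport. [this file] -/
theorem regluingOfSphereFour_zero_of_rungOne (h1 : SblfDescent.RungOne) : RegluingOfSphereFour 0 :=
  regluingOfSphereFour_of_recognition 0
    (fun X _ _ _ _ _ e hX => h1 X e ((sblfDescent_has_zero_iff X).mp hX))

/-- F3 for the GAP family modulo the published genus-one classification. [cite: Hayano2011, Cor. 4.11] -/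
theorem regluingOfSphereFour_zero_of_fact
    (H : nonempty_diffeomorph_sphere_four_of_sblf_genus_one) : RegluingOfSphereFour 0 :=
  regluingOfSphereFour_zero_of_rungOne (RungOne_of_sblfGenusOne H)

/-- NECESSITY of the gap for the crux: `StepTwo` and the floor `RungOne` give `TorusRegluingOfSphereFour`
(through the landed `genusTwoRecognition_of_stepTwo_of_rungOne`). [this file] -/
theorem torusRegluingOfSphereFour_of_stepTwo_of_rungOne (h2 : SblfDescent.StepTwo)
    (h1 : SblfDescent.RungOne) : TorusRegluingOfSphereFour :=
  regluingOfSphereFour_of_recognition 1 (genusTwoRecognition_of_stepTwo_of_rungOne h2 h1)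

/-- Genus-2 recognition (the apex of line `Sketch`; `= StepTwo` modulo the ADK and Hayano facts by
`stepTwo_iff_genusTwoRecognition`) from the gap + the rung. [this file] -/
theorem genusTwoRecognition_of_regluing (hA : TorusRegluingOfSphereFour)
    (hR : TorusRegluingRecognition) :
    ∀ (X : Type) [TopologicalSpace X] [T2Space X] [SecondCountableTopology X]
      [ChartedSpace (EuclideanSpace ℝ (Fin 4)) X] [IsManifold (𝓡 4) ((⊤ : ℕ∞) : WithTop ℕ∞) X],
      X ≃ₕ 𝕊⁴ →
      (∃ (o : SmoothOrientation (𝓡 4) X) (f : X → 𝕊²) (L : Finset X),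
          IsSimplifiedBrokenLefschetzFibration o f L 1) →
      Nonempty (Diffeomorph (𝓡 4) (𝓡 4) X 𝕊⁴ ((⊤ : ℕ∞) : WithTop ℕ∞)) := by
  intro X _ _ _ _ _ e hX
  obtain ⟨o, f, L, hf⟩ := hX
  obtain ⟨f₀, hf₀, y₀, hy₀, Ψ, hΨ⟩ := hA X e f ⟨o, L, hf⟩
  exact hR X e f ⟨o, L, hf⟩ f₀ hf₀ y₀ hy₀ Ψ hΨ

/-! ## Registered stubs -/

/-- STUB (gap, hardest — census half: every genus-2 Hurwitz cycle system `(c; c₁, …, c₄)` of a homotopy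
4-sphere is realised, up to Hurwitz equivalence, by a simplified broken Lefschetz fibration of `S⁴`, and
equivalent systems give fibrewise-diffeomorphic (higher side ∪ round cobordism) — Baykur–Hayano's `Φ_h ∪ Φ_r`,
which need `g ≥ 2` only; SPC4-shielded like every on-path statement; necessary for the crux by
`torusRegluingOfSphereFour_of_stepTwo_of_rungOne`).  Size XL. -/
theorem stub_torusRegluingOfSphereFour : TorusRegluingOfSphereFour := by
  sorry

/-- STUB (rung — one multiplicity-one logarithmic transformation of `S⁴` along a lower torus fibre `F₀` of a
genus-2 simplified broken Lefschetz fibration, in a direction `(a, b) ∈ H₁(F₀)` keeping the result a homotopy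
sphere, gives `S⁴`.  Tools: Montesinos' theorem when `F₀` is unknotted (tree fact
`nonempty_diffeomorph_sphere_four_of_torusSurgery_unknotted`; first internal lemma: fibred agreement off
`F₀` ⇒ `IsTorusLinkSurgery (𝓡 4) X 1 T A` with `T` a framed tube of `F₀`), Iwase's analysis for torus
`T²`-knots, Gompf's nucleus lemma for directions parallel to a vanishing cycle pushed to the lower side,
Kirby calculus of `Σ₂ × D² ∪ 4 h² ∪ R₂ ∪_γ T² × D²` per system (Hayano–Sato arXiv:1110.0161 Thm. 5.5 does
it for one system).  Size L–XL. -/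
theorem stub_torusRegluingRecognition : TorusRegluingRecognition := by
  sorry

/-! ## Skeleton -/

/-- **COMPOSITION / SKELETON** (kernel-checked; the only sorries are the two registered stubs, used BY
NAME): write the fibration as a torus regluing of one on `S⁴` (`stub_torusRegluingOfSphereFour`), recognise
the regluing (`stub_torusRegluingRecognition`) — together genus-2 recognition (`genusTwoRecognition_of_regluing`) —
and transport ADK's genus-1 fibration of `S⁴` through the landed reduction
`helper_stepTwo_of_genusTwoRecognition` (p153819); concludes the crux BY NAME.  The same composition with the
stub STATEMENTS as hypotheses, sorry-free, is `stepTwo_of_regluing` in `Lines/TorusRegluingRecognition_onpath.lean`. -/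
theorem StepTwo_of : Summit.SmoothPoincare4.SmoothPoincare4.Theses.SblfDescent.StepTwo :=
  helper_stepTwo_of_genusTwoRecognition
    (genusTwoRecognition_of_regluing stub_torusRegluingOfSphereFour stub_torusRegluingRecognition)
    exists_sblf_genus_one_noLefschetz_sphere_four_holds

end Summit.SmoothPoincare4.SmoothPoincare4.Cruxes.StepTwo.FibredRegluing
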